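import Mathlib

/-!
# T5DyadicExamples — the decidable arithmetic behind N2.8.2(b) and (e)

Kernel witness (cell pub-hodge-repro2, seat p3, Tier-5 support for sub-step N2) for the
arithmetic one-liners of route/T5-N2-route-3.md §N2.8.2:

* (b) «the conductor of a cyclic cubic field is a product of distinct primes ≡ 1 (mod 3) and
  possibly 9 …, so 2 is inert (g₂ = 1, …) or splits completely (g₂ = 3, …)»;
* (e) «Examples re-checked: ℚ(ζ₇) — ord_7(2) = 3 ⟹ g₂ = 1; −7 ≡ 1 (mod 8) ⟹ 2 splits in
  ℚ(√−7) …; ℚ(ζ₉) — ord_9(2) = 6 ⟹ 2 inert in E …; … F⁺ of conductor 31 …: 2 ≡ 4³ (mod 31) ⟹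
  2 splits completely; 2 ≡ 4³ = 64 ≡ 2 (mod 31) ✓ cube».

What is kernel-checked here (Mathlib only; every statement decided or proved from `Nat.Prime`):

* `odd_of_prime_of_mod_three_eq_one`, `odd_conductor_shape`: a prime `p ≡ 1 (mod 3)` is odd, and
  `3 ^ a · ∏ pᵢ` with every `pᵢ` such a prime is odd — «2 does not divide the conductor».
* `inert_or_split_of_unramified`: `e · f · g = 3` with `e = 1` forces `(f, g) = (3, 1)` or
  `(1, 3)` — the «inert or splits completely» alternative for an unramified prime in a cubic
  Galois extension (the relation `e f g = [F⁺ : ℚ]` with `f` constant is the printed Dedekind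
  theory, prose).
* `orderOf_two_zmod_seven : orderOf (2 : ZMod 7) = 3` (ℚ(ζ₇): the residue degree of 2 in
  ℚ(ζ₇) is the order of 2 mod 7 — prose; here the order itself);
* `neg_seven_zmod_eight : (-7 : ZMod 8) = 1` (2 splits in ℚ(√−7) by the Dedekind–Kummer
  criterion — prose; here the congruence itself);
* `orderOf_two_zmod_nine : orderOf (2 : ZMod 9) = 6` (ℚ(ζ₉): 2 inert);
* `two_eq_four_pow_three_zmod_31 : (2 : ZMod 31) = 4 ^ 3`, `two_is_cube_zmod_31`, and the cube
  roots of unity `cube_roots_of_unity_zmod_31 : x ^ 3 = 1 ↔ x = 1 ∨ x = 5 ∨ x = 25` — so the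
  cubes form a subgroup of index 3 in `(ℤ/31)^×` (the image of a homomorphism of a group of order
  30 with a kernel of order 3) and 2 lies in it; that this subgroup is the norm group of the
  cubic field of conductor 31 is class field theory, prose.

README §8(d): this file uses an L-value-free non-vanishing device: NO.
-/

namespace Summit.Ventures.HodgeRepro2.T5DyadicExamples

section Conductor

/-- A prime `p ≡ 1 (mod 3)` is odd (it is not `2`, because `2 ≡ 2 (mod 3)`). -/
theorem odd_of_prime_of_mod_three_eq_one {p : ℕ} (hp : p.Prime) (h3 : p % 3 = 1) : Odd p := by
  rcases hp.eq_two_or_odd' with rfl | hodd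
  · norm_num at h3
  · exact hodd

/-- «The conductor of a cyclic cubic field is a product of distinct primes ≡ 1 (mod 3) and possibly
9»: any number of that shape, `3 ^ a * ∏ pᵢ` with every `pᵢ` a prime `≡ 1 (mod 3)`, is odd — so
`2` never divides it. -/
theorem odd_conductor_shape (a : ℕ) (l : List ℕ) (hl : ∀ p ∈ l, p.Prime ∧ p % 3 = 1) :
    Odd (3 ^ a * l.prod) := by
  refine Odd.mul (Odd.pow (by decide)) ?_
  induction l with
  | nil => simp
  | cons p l ih =>
    rw [List.prod_cons]
    exact Odd.mul (odd_of_prime_of_mod_three_eq_one (hl p (List.mem_cons_self ..)).1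
      (hl p (List.mem_cons_self ..)).2)
      (ih fun q hq => hl q (List.mem_cons_of_mem p hq))

/-- An unramified prime (`e = 1`) in an extension of degree `3` with `e · f · g = 3` is either
inert (`f = 3`, `g = 1`) or splits completely (`f = 1`, `g = 3`). -/
theorem inert_or_split_of_unramified {e f g : ℕ} (h : e * f * g = 3) (he : e = 1) :
    (f = 3 ∧ g = 1) ∨ (f = 1 ∧ g = 3) := by
  subst he
  rw [one_mul] at h
  rcases Nat.prime_three.eq_one_or_self_of_dvd f ⟨g, h.symm⟩ with hf | hf
  · subst hf
    exact Or.inr ⟨rfl, by omega⟩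
  · subst hf
    exact Or.inl ⟨rfl, by omega⟩

end Conductor

section Examples

/-- ℚ(ζ₇): the order of `2` modulo `7` is `3`. -/
theorem orderOf_two_zmod_seven : orderOf (2 : ZMod 7) = 3 := by
  rw [orderOf_eq_iff (by norm_num)]
  exact ⟨by decide, by decide⟩

/-- ℚ(√−7): `−7 ≡ 1 (mod 8)`. -/
theorem neg_seven_zmod_eight : (-7 : ZMod 8) = 1 := by decide

/-- ℚ(ζ₉): the order of `2` modulo `9` is `6`. -/
theorem orderOf_two_zmod_nine : orderOf (2 : ZMod 9) = 6 := by
  rw [orderOf_eq_iff (by norm_num)]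
  exact ⟨by decide, by decide⟩

/-- Conductor `31`: `2 ≡ 4³ (mod 31)`. -/
theorem two_eq_four_pow_three_zmod_31 : (2 : ZMod 31) = 4 ^ 3 := by decide

/-- `2` is a cube modulo `31`. -/
theorem two_is_cube_zmod_31 : ∃ x : ZMod 31, x ^ 3 = 2 :=
  ⟨4, two_eq_four_pow_three_zmod_31.symm⟩

/-- The cube roots of unity modulo `31` are `1, 5, 25`: the cubing map on `(ℤ/31)^×` has a kernel
of order `3`, so its image (the cubes) has index `3`. -/
theorem cube_roots_of_unity_zmod_31 (x : ZMod 31) : x ^ 3 = 1 ↔ x = 1 ∨ x = 5 ∨ x = 25 := by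
  revert x
  decide

end Examples

end Summit.Ventures.HodgeRepro2.T5DyadicExamples
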